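import Literature.Analysis.FluidPDE.SelfSimilarEulerBernoulliGradient
import HarnessLib

/-!
# The Bernoulli-top stagnation point of a self-similar Euler profile is never vortical

Analysis/FluidPDE proofs file (theorems only), sequel of `SelfSimilarEulerBernoulliGradient.lean`
(fifth part of the Eulerian treatment of Constantin–Ignatova–Vicol 2026, arXiv:2602.17570,
§3.4.3–§3.5). With `B = DU(z)` at a stagnation point `z` of `V = γ(y−c) + U` and `A = γ + B =
DV(z)`, the second variation of the Bernoulli function `ℋ` along a ray is the quadratic form
`v ↦ (2γ−1)⟪A v, v⟫ + ⟪A v, B v⟫ − ⟪B(A v), v⟫`, non-positive at a local maximum of `ℋ`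
(`rayHessian_nonpos_of_isLocalMax`). Here:

* `exists_rayForm_pos` — **linear algebra**: if `tr B = 0` and `B` has a unit eigenvector `e`
  with eigenvalue `1`, the form is POSITIVE in some direction whenever `γ ≠ ½` (over an
  orthonormal frame through `e` its values sum to `3γ(2γ−1) + (|B|_F² − tr B²) ≥ 3γ(2γ−1)`, while
  the value at `e` is `(2γ−1)(γ+1)`; the two other values sum to at least `(2γ−1)² > 0`);
* `IsSelfSimilarEulerProfile.not_isLocalMax_selfSimilarBernoulli_of_curl_ne_zero` — hence **a
  VORTICAL stagnation point (`Ω(z) ≠ 0`, so `DU(z)Ω(z) = Ω(z)` by (3.4), CIV's proof of Thm. 3.8)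
  is never a local maximum of `ℋ`** (`γ ≠ ½`);
* `IsSelfSimilarEulerProfile.inner_fderiv_le_of_isLocalMax_selfSimilarBernoulli` — and **a
  stagnation point that IS a local maximum of `ℋ` is a GOOD node**: `DV(z) ≥ 0`, so
  `⟪DU(z) w, w⟫ ≤ 2γ|w|²` (`< |w|²` in the window `γ < ½`), the hypothesis under which
  `SelfSimilarEulerStagnationStretching` / `SelfSimilarEulerBernoulliSuperlevel` make the
  vorticity vanish.

Consumer: `SelfSimilarEulerBernoulliMaximum.lean` (under the far field (3.8), `ℋ → −∞`, so `ℋ`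
attains its maximum at a good stagnation point; a nontrivial in-window profile therefore has at
least two stagnation points).

## References

* P. Constantin, M. Ignatova, V. Vicol, arXiv:2602.17570 (2026), §3.4.3 (3.29)–(3.33), §3.5
  Thm. 3.8. [ConstantinIgnatovaVicol2026Putative]

## Mathlib / tree search

Reused: `rayHessian_nonpos_of_isLocalMax`, `isSymmetric_fderiv_of_curl_eq_zero`,
`fderiv_apply_curl_eq_of_mem_nodalSet`, `inner_apply_self_le_trace_sub_mul`. Mathlib:
`Orthonormal.exists_orthonormalBasis_extension`, `LinearMap.trace_eq_sum_inner`,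
`OrthonormalBasis.sum_repr'`, `OrthonormalBasis.sum_inner_mul_inner`.
-/

noncomputable section

open Set Filter Topology InnerProductSpace Metric
open scoped RealInnerProductSpace

namespace Literature.Analysis.FluidPDE

section Algebra

/-- **Linear algebra of the vortical case.** Let `B` be a trace-free endomorphism of `ℝ³` with a
unit eigenvector `e`, `B e = e`, and `γ ≠ ½`. Then the quadratic form
`v ↦ (2γ−1)⟪γv + Bv, v⟫ + ⟪γv + Bv, Bv⟫ − ⟪B(γv + Bv), v⟫ = (2γ−1)(γ|v|² + ⟪Bv, v⟫) + |Bv|² − ⟪B²v, v⟫`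
is positive in some direction: over an orthonormal frame through `e` the values sum to
`3γ(2γ−1) + (|B|_F² − tr B²) ≥ 3γ(2γ−1)` (`tr B² ≤ |B|_F²`: `2 m_{ij} m_{ji} ≤ m_{ij}² + m_{ji}²`),
while the value at `e` is `(2γ−1)(γ+1)`; the remaining two values sum to at least `(2γ−1)² > 0`.
[cite: ConstantinIgnatovaVicol2026Putative, §3.5 proof of Thm. 3.8 (eigenvalue-one direction; the second-variation bookkeeping is not in print)] -/
theorem exists_rayForm_pos
    {B : EuclideanSpace ℝ (Fin 3) →L[ℝ] EuclideanSpace ℝ (Fin 3)}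
    (htr : LinearMap.trace ℝ _
      (B : EuclideanSpace ℝ (Fin 3) →ₗ[ℝ] EuclideanSpace ℝ (Fin 3)) = 0)
    {e : EuclideanSpace ℝ (Fin 3)} (he : ‖e‖ = 1) (hBe : B e = e) {γ : ℝ} (hγ : γ ≠ 1 / 2) :
    ∃ v : EuclideanSpace ℝ (Fin 3), 0 < (2 * γ - 1) * ⟪γ • v + B v, v⟫ +
      (⟪γ • v + B v, B v⟫ - ⟪B (γ • v + B v), v⟫) := by
  classical
  by_contra hcon
  push Not at hcon
  -- the form, simplified
  have hL : ∀ v : EuclideanSpace ℝ (Fin 3), (2 * γ - 1) * ⟪γ • v + B v, v⟫ +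
      (⟪γ • v + B v, B v⟫ - ⟪B (γ • v + B v), v⟫) =
      (2 * γ - 1) * (γ * ‖v‖ ^ 2 + ⟪B v, v⟫) + (‖B v‖ ^ 2 - ⟪B (B v), v⟫) := by
    intro v
    rw [map_add, map_smul, inner_add_left, inner_add_left, inner_add_left, inner_smul_left,
      inner_smul_left, inner_smul_left, real_inner_self_eq_norm_sq, real_inner_self_eq_norm_sq,
      real_inner_comm (B v) v]
    simp only [conj_trivial]
    ring
  -- an orthonormal basis through `e`
  have hon : Orthonormal ℝ ((↑) : ({e} : Set (EuclideanSpace ℝ (Fin 3))) → EuclideanSpace ℝ (Fin 3)) := by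
    rw [orthonormal_subtype_iff_ite]
    intro v hv v' hv'
    rw [Set.mem_singleton_iff] at hv hv'
    subst hv; subst hv'
    simp [he]
  obtain ⟨u, b, heu, hb⟩ := hon.exists_orthonormalBasis_extension
  have he_mem : e ∈ u := by
    have : e ∈ ({e} : Set (EuclideanSpace ℝ (Fin 3))) := Set.mem_singleton e
    exact_mod_cast heu this
  set i₀ : u := ⟨e, he_mem⟩ with hi₀
  have hbi₀ : b i₀ = e := by rw [hb]
  have hcard : (Fintype.card u : ℝ) = 3 := by
    have h1 : Module.finrank ℝ (EuclideanSpace ℝ (Fin 3)) = Fintype.card u :=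
      Module.finrank_eq_card_basis b.toBasis
    rw [finrank_euclideanSpace, Fintype.card_fin] at h1
    exact_mod_cast h1.symm
  -- `∑ ⟪B bᵢ, bᵢ⟫ = tr B = 0`
  have hsumB : ∑ i, ⟪B (b i), b i⟫ = 0 := by
    have ht := LinearMap.trace_eq_sum_inner
      (B : EuclideanSpace ℝ (Fin 3) →ₗ[ℝ] EuclideanSpace ℝ (Fin 3)) b
    rw [htr] at ht
    rw [show (∑ i, ⟪B (b i), b i⟫) = ∑ i, ⟪b i, (B : EuclideanSpace ℝ (Fin 3) →ₗ[ℝ]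
        EuclideanSpace ℝ (Fin 3)) (b i)⟫ from Finset.sum_congr rfl fun i _ => by
          rw [real_inner_comm]; rfl]
    exact ht.symm
  have hsum1 : ∑ i : u, ‖b i‖ ^ 2 = 3 := by
    have : ∀ i, ‖b i‖ ^ 2 = 1 := fun i => by rw [b.orthonormal.1 i, one_pow]
    simp only [this, Finset.sum_const, Finset.card_univ, nsmul_eq_mul, mul_one]
    exact hcard
  -- the matrix inequality `∑ ⟪B (B bᵢ), bᵢ⟫ ≤ ∑ ‖B bᵢ‖²`
  set m : u → u → ℝ := fun i j => ⟪b i, B (b j)⟫ with hm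
  have hBB : ∀ j, ⟪B (B (b j)), b j⟫ = ∑ i, m i j * m j i := by
    intro j
    have hrep : B (b j) = ∑ i, m i j • b i := by
      rw [hm]; exact (b.sum_repr' (B (b j))).symm
    conv_lhs => rw [hrep]
    rw [map_sum, sum_inner]
    refine Finset.sum_congr rfl fun i _ => ?_
    rw [map_smul, inner_smul_left, conj_trivial, hm, real_inner_comm (b j)]
  have hBn : ∀ j, ‖B (b j)‖ ^ 2 = ∑ i, m i j * m i j := by
    intro j
    rw [← real_inner_self_eq_norm_sq, ← b.sum_inner_mul_inner (B (b j)) (B (b j))]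
    refine Finset.sum_congr rfl fun i _ => ?_
    rw [hm, real_inner_comm (b i) (B (b j))]
  have hmat : ∑ j, ⟪B (B (b j)), b j⟫ ≤ ∑ j, ‖B (b j)‖ ^ 2 := by
    simp_rw [hBB, hBn]
    have h2 : 2 * ∑ j, ∑ i, m i j * m j i ≤ ∑ j, ∑ i, m i j * m i j + ∑ j, ∑ i, m j i * m j i := by
      rw [← Finset.sum_add_distrib, Finset.mul_sum]
      refine Finset.sum_le_sum fun j _ => ?_
      rw [← Finset.sum_add_distrib, Finset.mul_sum]
      refine Finset.sum_le_sum fun i _ => ?_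
      nlinarith [sq_nonneg (m i j - m j i)]
    have h3 : ∑ j, ∑ i, m j i * m j i = ∑ j, ∑ i, m i j * m i j := Finset.sum_comm
    linarith
  -- the value of the form at `e`
  have hLe : (2 * γ - 1) * (γ * ‖e‖ ^ 2 + ⟪B e, e⟫) + (‖B e‖ ^ 2 - ⟪B (B e), e⟫) =
      (2 * γ - 1) * (γ + 1) := by
    rw [hBe, hBe, he, real_inner_self_eq_norm_sq, he]; ring
  -- sum of the form over the basis
  have hsumL : ∑ i, ((2 * γ - 1) * (γ * ‖b i‖ ^ 2 + ⟪B (b i), b i⟫) +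
      (‖B (b i)‖ ^ 2 - ⟪B (B (b i)), b i⟫)) =
      (2 * γ - 1) * γ * (∑ i, ‖b i‖ ^ 2) + (2 * γ - 1) * (∑ i, ⟪B (b i), b i⟫) +
        ((∑ i, ‖B (b i)‖ ^ 2) - ∑ i, ⟪B (B (b i)), b i⟫) := by
    have e : ∀ i, ((2 * γ - 1) * (γ * ‖b i‖ ^ 2 + ⟪B (b i), b i⟫) +
        (‖B (b i)‖ ^ 2 - ⟪B (B (b i)), b i⟫)) = (2 * γ - 1) * γ * ‖b i‖ ^ 2 +
        (2 * γ - 1) * ⟪B (b i), b i⟫ + (‖B (b i)‖ ^ 2 - ⟪B (B (b i)), b i⟫) := fun i => by ring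
    simp only [e, Finset.sum_add_distrib, Finset.sum_sub_distrib, ← Finset.mul_sum]
  -- each term is `≤ 0` by assumption, and the `e`-term equals `(2γ−1)(γ+1)`
  have hle : ∑ i, ((2 * γ - 1) * (γ * ‖b i‖ ^ 2 + ⟪B (b i), b i⟫) +
      (‖B (b i)‖ ^ 2 - ⟪B (B (b i)), b i⟫)) ≤ (2 * γ - 1) * (γ + 1) := by
    rw [← Finset.add_sum_erase Finset.univ _ (Finset.mem_univ i₀), hbi₀, hLe]
    have : ∑ i ∈ Finset.univ.erase i₀, ((2 * γ - 1) * (γ * ‖b i‖ ^ 2 + ⟪B (b i), b i⟫) +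
        (‖B (b i)‖ ^ 2 - ⟪B (B (b i)), b i⟫)) ≤ 0 := by
      refine Finset.sum_nonpos fun i _ => ?_
      rw [← hL]
      exact hcon (b i)
    linarith
  rw [hsumL, hsum1, hsumB] at hle
  have hsq : 0 < (2 * γ - 1) * (2 * γ - 1) := by
    have : 2 * γ - 1 ≠ 0 := by
      intro h0; apply hγ; linarith
    exact mul_self_pos.2 this
  nlinarith

end Algebra

namespace IsSelfSimilarEulerProfile

section LocalMax

variable {γ : ℝ} {c : EuclideanSpace ℝ (Fin 3)}
  {U : EuclideanSpace ℝ (Fin 3) → EuclideanSpace ℝ (Fin 3)} {P : EuclideanSpace ℝ (Fin 3) → ℝ}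

/-- **A vortical stagnation point is never a local maximum of the Bernoulli function** (`γ ≠ ½`).
At a stagnation point `z` with `Ω(z) ≠ 0` the vorticity equation (3.4) gives `DU(z)Ω(z) = Ω(z)`
(tree: `fderiv_apply_curl_eq_of_mem_nodalSet`) and `tr DU(z) = 0`; the linear algebra
`exists_rayForm_pos` produces a direction of positive second variation, contradicting
`rayHessian_nonpos_of_isLocalMax`. [cite: ConstantinIgnatovaVicol2026Putative, §3.5 Thm. 3.8 (eigenvalue one at a vortical node; consequence not in print)] -/
theorem not_isLocalMax_selfSimilarBernoulli_of_curl_ne_zero (h : IsSelfSimilarEulerProfile γ c U P)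
    (hγ : γ ≠ 1 / 2) {z : EuclideanSpace ℝ (Fin 3)} (hz : z ∈ selfSimilarNodalSet γ c U)
    (hΩ : curl U z ≠ 0) : ¬ IsLocalMax (selfSimilarBernoulli γ c U P) z := by
  intro hmax
  have hV := h.isSelfSimilarEulerVorticityProfile
  set e : EuclideanSpace ℝ (Fin 3) := ‖curl U z‖⁻¹ • curl U z with he_def
  have hn : ‖curl U z‖ ≠ 0 := norm_ne_zero_iff.2 hΩ
  have he1 : ‖e‖ = 1 := by
    rw [he_def, norm_smul, norm_inv, norm_norm, inv_mul_cancel₀ hn]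
  have hBe : fderiv ℝ U z e = e := by
    rw [he_def, map_smul, hV.fderiv_apply_curl_eq_of_mem_nodalSet hz]
  have hdiv : LinearMap.trace ℝ _ (fderiv ℝ U z :
      EuclideanSpace ℝ (Fin 3) →ₗ[ℝ] EuclideanSpace ℝ (Fin 3)) = 0 := h.divFree z
  obtain ⟨v, hv⟩ := exists_rayForm_pos hdiv he1 hBe hγ
  have := h.rayHessian_nonpos_of_isLocalMax hz hmax v
  linarith

/-- **A stagnation point that is a local maximum of the Bernoulli function is a GOOD node**
(`γ < ½`): it is non-vortical (previous theorem), so `DU(z)` is symmetric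
(`isSymmetric_fderiv_of_curl_eq_zero`) and the second-order test reduces to
`(2γ−1)⟪(γ + DU(z)) v, v⟫ ≤ 0`, i.e. `DV(z) = γ I + DU(z) ≥ 0`; with `tr DU(z) = 0` this gives
`⟪DU(z) w, w⟫ ≤ 2γ|w|²` for all `w` (`inner_apply_self_le_trace_sub_mul`) — stretching rates
`< |w|²` in the window, the hypothesis of `curl_eq_zero_of_stagnation_stretching_le`.
[cite: ConstantinIgnatovaVicol2026Putative, §3.4.3–§3.5 (second-order structure at the Bernoulli maximum; not in print)] -/
theorem inner_fderiv_le_of_isLocalMax_selfSimilarBernoulli (h : IsSelfSimilarEulerProfile γ c U P)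
    (hγ2 : γ < 1 / 2) {z : EuclideanSpace ℝ (Fin 3)} (hz : z ∈ selfSimilarNodalSet γ c U)
    (hmax : IsLocalMax (selfSimilarBernoulli γ c U P) z) (w : EuclideanSpace ℝ (Fin 3)) :
    ⟪fderiv ℝ U z w, w⟫ ≤ 2 * γ * ‖w‖ ^ 2 := by
  have hγ : γ ≠ 1 / 2 := by intro h0; linarith
  have hΩ : curl U z = 0 := by
    by_contra hne
    exact h.not_isLocalMax_selfSimilarBernoulli_of_curl_ne_zero hγ hz hne hmax
  have hUd : Differentiable ℝ U := h.contDiff_velocity.differentiable (by norm_num)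
  have hS := isSymmetric_fderiv_of_curl_eq_zero (hUd z) hΩ
  -- the ray condition with a symmetric `DU(z)` gives `⟪(γ + DU) v, v⟫ ≥ 0`
  have hq : ∀ v : EuclideanSpace ℝ (Fin 3), -γ * ‖v‖ ^ 2 ≤ ⟪fderiv ℝ U z v, v⟫ := by
    intro v
    have hr := h.rayHessian_nonpos_of_isLocalMax hz hmax v
    have hsym : ⟪fderiv ℝ U z (γ • v + fderiv ℝ U z v), v⟫ =
        ⟪γ • v + fderiv ℝ U z v, fderiv ℝ U z v⟫ := hS _ _
    rw [hsym, sub_self, add_zero, inner_add_left, inner_smul_left, conj_trivial,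
      real_inner_self_eq_norm_sq] at hr
    have h2 : 2 * γ - 1 < 0 := by linarith
    have : 0 ≤ γ * ‖v‖ ^ 2 + ⟪fderiv ℝ U z v, v⟫ := by
      by_contra hlt
      have : 0 < (2 * γ - 1) * (γ * ‖v‖ ^ 2 + ⟪fderiv ℝ U z v, v⟫) :=
        mul_pos_of_neg_of_neg h2 (not_le.1 hlt)
      linarith
    linarith
  have htr := inner_apply_self_le_trace_sub_mul hq w
  have hdiv : LinearMap.trace ℝ _ (fderiv ℝ U z :
      EuclideanSpace ℝ (Fin 3) →ₗ[ℝ] EuclideanSpace ℝ (Fin 3)) = 0 := h.divFree z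
  rw [hdiv, finrank_euclideanSpace, Fintype.card_fin] at htr
  norm_num at htr
  linarith

end LocalMax

end IsSelfSimilarEulerProfile

end Literature.Analysis.FluidPDE

end
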